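import Mathlib.Topology.Homotopy.Path
import HarnessLib

/-!
# Segments of a path and the reparametrisation principle

Topic `Literature/AlgebraicTopology/FundamentalGroup`; elementary path bookkeeping used by the
fact seat `provefact-Literature.Topology.FourManifolds.exists-cbed50d78a` to identify explicit
loops on a spine with words in standard loops.

* `homotopic_of_extend` — the **reparametrisation principle**: two paths `δ₁`, `δ₂ : Path a b`
  that factor through `γ.extend : ℝ → X` for one path `γ`, `δᵢ = γ.extend ∘ pᵢ` with continuous
  parameter functions `pᵢ : I → ℝ` agreeing at `0` and at `1`, are homotopic rel end points
  (interpolate the parameters linearly; no monotonicity or range condition is needed).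
* `segment γ a b : Path (γ.extend a) (γ.extend b)` — the affinely reparametrised piece of `γ`
  between the parameters `a` and `b` (any reals); `segment_trans_segment`:
  `γ[a,b] · γ[b,c] ≃ γ[a,c]`; `segment_zero_one`: `γ[0,1] = γ`; `segment_symm`:
  `γ[a,b]⁻¹ = γ[b,a]`; constant segments are constant paths; `map_extend`,
  `segment_map_apply`, `eq_segment_of_forall`.

Everything is proved; no named facts. [folklore]
-/

open Set Function
open scoped Topology unitInterval

noncomputable section

namespace Literature.AlgebraicTopology.FundamentalGroup

namespace PathSegment

variable {X : Type*} [TopologicalSpace X] {x y a b : X}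

/-- **The reparametrisation principle.**  Two paths which factor through the extension
`γ.extend : ℝ → X` of one path `γ`, with continuous parameter functions agreeing at the two end
points, are homotopic rel end points: interpolate the parameters linearly. [folklore] -/
theorem homotopic_of_extend (γ : Path x y) (δ₁ δ₂ : Path a b) (p₁ p₂ : I → ℝ)
    (hp₁ : Continuous p₁) (hp₂ : Continuous p₂) (h₁ : ∀ t, δ₁ t = γ.extend (p₁ t))
    (h₂ : ∀ t, δ₂ t = γ.extend (p₂ t)) (h0 : p₁ 0 = p₂ 0) (h1 : p₁ 1 = p₂ 1) :
    δ₁.Homotopic δ₂ := by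
  refine ⟨{ toFun := fun q => γ.extend ((1 - (q.1 : ℝ)) * p₁ q.2 + (q.1 : ℝ) * p₂ q.2)
            continuous_toFun := by
              refine γ.continuous_extend.comp ?_
              fun_prop
            map_zero_left := fun t => by simp [h₁ t]
            map_one_left := fun t => by simp [h₂ t]
            prop' := fun s t ht => ?_ }⟩
  simp only [mem_insert_iff, mem_singleton_iff] at ht
  show γ.extend ((1 - (s : ℝ)) * p₁ t + (s : ℝ) * p₂ t) = δ₁ t
  rcases ht with rfl | rfl
  · rw [h₁, ← h0]; congr 1; ring
  · rw [h₁, ← h1]; congr 1; ring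

/-- **The segment** of a path between the parameters `a` and `b` (affinely reparametrised; for
`a > b` it runs backwards, outside `[0, 1]` the path is extended by constants). [folklore] -/
def segment (γ : Path x y) (a b : ℝ) : Path (γ.extend a) (γ.extend b) where
  toFun s := γ.extend (a + (b - a) * s)
  continuous_toFun := γ.continuous_extend.comp (by fun_prop)
  source' := by simp
  target' := by simp

/-- The segment, evaluated. [folklore] -/
theorem segment_apply (γ : Path x y) (a b : ℝ) (s : I) : segment γ a b s = γ.extend (a + (b - a) * s) :=
  rfl

/-- **Splitting a segment**: `γ[a, c] ≃ γ[a, b] · γ[b, c]` (any `a b c : ℝ`). [folklore] -/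
theorem segment_trans_segment (γ : Path x y) (a b c : ℝ) :
    ((segment γ a b).trans (segment γ b c)).Homotopic (segment γ a c) := by
  refine homotopic_of_extend γ _ _
    (fun t => if (t : ℝ) ≤ 1 / 2 then a + (b - a) * (2 * t) else b + (c - b) * (2 * t - 1))
    (fun t => a + (c - a) * t) ?_ (by fun_prop) (fun t => ?_) (fun t => rfl) (by norm_num)
    (by norm_num)
  · refine Continuous.if_le ?_ ?_ (by fun_prop) continuous_const fun t ht => ?_
    · fun_prop
    · fun_prop
    · rw [ht]; ring
  · rw [Path.trans_apply]
    split_ifs with h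
    · rw [segment_apply]
    · rw [segment_apply]

/-- The whole path is its segment `[0, 1]`. [folklore] -/
theorem segment_zero_one (γ : Path x y) :
    (segment γ 0 1).cast γ.extend_zero.symm γ.extend_one.symm = γ := by
  ext s
  rw [Path.cast_coe, segment_apply, zero_add, sub_zero, one_mul, Path.extend_extends']

/-- The whole path is homotopic to its segment `[0, 1]` (cast). [folklore] -/
theorem homotopic_segment_zero_one (γ : Path x y) :
    γ.Homotopic ((segment γ 0 1).cast γ.extend_zero.symm γ.extend_one.symm) := by
  rw [segment_zero_one]

/-- The reversed segment is the segment run backwards. [folklore] -/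
theorem segment_symm (γ : Path x y) (a b : ℝ) : (segment γ a b).symm = segment γ b a := by
  ext s
  show γ.extend (a + (b - a) * (σ s : ℝ)) = γ.extend (b + (a - b) * s)
  rw [unitInterval.coe_symm_eq]
  congr 1; ring

/-- **A segment on which the path is constant is a constant path.** [folklore] -/
theorem segment_eq_refl_of_const (γ : Path x y) {a b : ℝ} {z : X}
    (h : ∀ s : I, γ.extend (a + (b - a) * s) = z) (ha : γ.extend a = z) (hb : γ.extend b = z) :
    segment γ a b = (Path.refl z).cast ha hb := by
  ext s
  rw [segment_apply, h s, Path.cast_coe, Path.refl_apply]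

/-- A segment on which the path is constant is homotopic to the constant path (in the cast form
used inside words). [folklore] -/
theorem segment_homotopic_refl_of_const (γ : Path x y) {a b : ℝ} {z : X}
    (h : ∀ s : I, γ.extend (a + (b - a) * s) = z) (ha : γ.extend a = z) (hb : γ.extend b = z) :
    ((segment γ a b).cast ha.symm hb.symm).Homotopic (Path.refl z) := by
  have : (segment γ a b).cast ha.symm hb.symm = Path.refl z := by
    ext s
    rw [Path.cast_coe, segment_apply, h s, Path.refl_apply]
  rw [this]

/-- The extension of the image path is the image of the extension. [folklore] -/
theorem map_extend (γ : Path x y) {Y : Type*} [TopologicalSpace Y] {f : X → Y} (hf : Continuous f)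
    (t : ℝ) : (γ.map hf).extend t = f (γ.extend t) := rfl

/-- Segments commute with continuous maps (pointwise). [folklore] -/
theorem segment_map_apply (γ : Path x y) (a b : ℝ) {Y : Type*} [TopologicalSpace Y] {f : X → Y}
    (hf : Continuous f) (s : I) : (segment γ a b).map hf s = segment (γ.map hf) a b s := rfl

/-- **Pointwise description of a segment**: if `δ` agrees with `γ.extend` along the affine
parameter, then `δ` is the segment (as paths, after casting the end points). [folklore] -/
theorem eq_segment_of_forall (γ : Path x y) (a b : ℝ) (δ : Path (γ.extend a) (γ.extend b))
    (h : ∀ s : I, δ s = γ.extend (a + (b - a) * s)) : δ = segment γ a b := by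
  ext s; exact h s

end PathSegment

end Literature.AlgebraicTopology.FundamentalGroup
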